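import Mathlib
import Literature.AlgebraicGeometry.Resolution.QuadraticTransforms
import Literature.RingTheory.KrullDimension.AffineDimension
import HarnessLib

/-!
# Crux `Steer` (stmt-ResolutionOfSingularities-16345), chain W4.1, p = 2 σ-residual, LOW half, §σ2.24 brick (T7c):
# an integral extension is never a quadratic transform

OURS (campaign `res-hironaka`, rung L ★L-G4, slot W4.1; seat res-type-096 g8; brick (T7c) of res-L0-w41-strat-2's §σ2.24
LOW TOWER INTERFACE, HANDED 2026-08-27T09:23:21Z «PROPOSED HAND res-type-096»; replaces the role of no printed item; NOT a statement
of the manuscript under review; AI-produced, weaker than expert review). Serves clause (T7) of `IsLowTowerTwo` (a partial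
normalisation step `Y n ≤ Y (n+1)` is NOT a quadratic transform).

* `IntegralNotQuadratic.map_maximalIdeal_eq_span_of_isQuadraticTransform` — in a quadratic transform `Y → Y'` with chart
  element `x`, `𝔪_Y · Y' = x · Y'` (`y = x · (y/x)`, `y/x ∈ Y[𝔪_Y/x] ⊆ Y'`);
* `IntegralNotQuadratic.not_isQuadraticTransform_of_isIntegral` — **(T7c)**: if `Y ≤ Y' ⊆ L` with `Y` a Noetherian local
  domain of dimension `≥ 2`, `Y'` Noetherian and INTEGRAL over `Y`, then `Y'` is not a quadratic transform of `Y`: otherwise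
  `𝔪_Y Y' = x Y'` is principal, every prime of `Y'` containing `x` lies over `𝔪_Y` and is maximal by integrality, so the maximal
  ideal of the local ring `Y'` is minimal over `(x)` and has height `≤ 1` (Krull), while `dim Y' = dim Y ≥ 2` (integral
  extensions preserve dimension, tree `Literature.RingTheory.KrullDimension.ringKrullDim_eq_of_isIntegral`).

[cite: Matsumura1987, Thm. 9.4 and Thm. 13.5] [cite: Cutkosky2014, §2.1] [folklore]
-/

noncomputable section

-- `Summit.<S>.<S>.…` duplicates the summit name by design (single-problem summit).
set_option linter.dupNamespace false

open IsLocalRing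

namespace Summit.ResolutionOfSingularities.ResolutionOfSingularities.Theorems.SwitchingDichotomy

namespace IntegralNotQuadratic

open Literature.AlgebraicGeometry.Resolution

universe u

variable {L : Type u} [Field L]

/-- **`𝔪_Y · Y' = x · Y'` along a quadratic transform** with chart element `x`: `blowupRing Y x ≤ Y'` gives `y/x ∈ Y'` for
`y ∈ 𝔪_Y`. [cite: Cutkosky2014, §2.1] [folklore] -/
theorem map_maximalIdeal_eq_span_of_blowupRing_le {Y Y' : Subring L} [IsLocalRing Y] (hle : Y ≤ Y') {x : Y}
    (hx : x ∈ maximalIdeal Y) (hx0 : x ≠ 0) (hbl : blowupRing Y (x : L) ≤ Y') :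
    (maximalIdeal Y).map (Subring.inclusion hle) = Ideal.span {Subring.inclusion hle x} := by
  apply le_antisymm
  · rw [Ideal.map_le_iff_le_comap]
    intro y hy
    rw [Ideal.mem_comap, Ideal.mem_span_singleton']
    have hyx : (y : L) / x ∈ Y' := hbl (div_mem_blowupRing (x : L) hy)
    refine ⟨⟨(y : L) / x, hyx⟩, Subtype.ext ?_⟩
    have hx0' : ((x : Y) : L) ≠ 0 := fun e => hx0 (Subtype.ext e)
    change (y : L) / x * (x : L) = (y : L)
    rw [div_mul_cancel₀ _ hx0']
  · rw [Ideal.span_singleton_le_iff_mem]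
    exact Ideal.mem_map_of_mem _ hx

/-- **(T7c) An integral extension is never a quadratic transform.** `Y ≤ Y' ⊆ L`, `Y` a Noetherian local domain of Krull
dimension `≥ 2`, `Y'` Noetherian and integral over `Y` ⟹ `¬ IsQuadraticTransform Y Y'`. [cite: Matsumura1987, Thm. 9.4 and Thm. 13.5]
[folklore] -/
theorem not_isQuadraticTransform_of_isIntegral {Y Y' : Subring L} (hle : Y ≤ Y') [IsLocalRing Y] [IsNoetherianRing Y]
    [IsNoetherianRing Y'] (hdim : (2 : WithBot ℕ∞) ≤ ringKrullDim Y)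
    (hint : letI := (Subring.inclusion hle).toAlgebra; Algebra.IsIntegral Y Y') :
    ¬ IsQuadraticTransform Y Y' := by
  classical
  letI alg : Algebra Y Y' := (Subring.inclusion hle).toAlgebra
  haveI : Algebra.IsIntegral Y Y' := hint
  intro hQT
  obtain ⟨_, x, hx, hx0, hloc', hbl, -, hdom⟩ := hQT
  haveI : IsLocalRing Y' := hloc'
  have hinj : Function.Injective (algebraMap Y Y') := fun a b h => by
    have := congrArg Subtype.val h
    exact Subtype.ext this
  -- `𝔪_Y Y' = (x)`
  have hmap : (maximalIdeal Y).map (algebraMap Y Y') = Ideal.span {algebraMap Y Y' x} :=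
    map_maximalIdeal_eq_span_of_blowupRing_le hle hx hx0 hbl
  -- `x` is a non-unit of `Y'` (domination)
  have hxm' : algebraMap Y Y' x ∈ maximalIdeal Y' := by
    rw [mem_maximalIdeal_iff_inv_not_mem] at hx ⊢
    rcases hx with h0 | hinv
    · exact Or.inl h0
    · exact Or.inr fun h => hinv (hdom.2 _ x.2 h)
  -- every prime of `Y'` containing `x` lies over `𝔪_Y`, hence is maximal
  have hmaxP : ∀ (P : Ideal Y') [P.IsPrime], algebraMap Y Y' x ∈ P → P = maximalIdeal Y' := by
    intro P _ hxP
    have hle' : maximalIdeal Y ≤ P.comap (algebraMap Y Y') := by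
      intro y hy
      rw [Ideal.mem_comap]
      have : algebraMap Y Y' y ∈ Ideal.span {algebraMap Y Y' x} := by
        rw [← hmap]; exact Ideal.mem_map_of_mem _ hy
      obtain ⟨c, hc⟩ := Ideal.mem_span_singleton'.mp this
      rw [← hc]; exact P.mul_mem_left _ hxP
    have hcomap : maximalIdeal Y = P.comap (algebraMap Y Y') :=
      (IsLocalRing.maximalIdeal.isMaximal Y).eq_of_le (Ideal.comap_isPrime _ P).ne_top' hle'
    haveI : (P.comap (algebraMap Y Y')).IsMaximal := hcomap ▸ IsLocalRing.maximalIdeal.isMaximal Y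
    exact IsLocalRing.eq_maximalIdeal (Ideal.isMaximal_of_isIntegral_of_isMaximal_comap (R := Y) P inferInstance)
  -- so `𝔪_{Y'}` is minimal over the principal ideal `(x)`: height `≤ 1`
  have hmin : maximalIdeal Y' ∈ (Ideal.span {algebraMap Y Y' x}).minimalPrimes := by
    refine ⟨⟨inferInstance, (Ideal.span_singleton_le_iff_mem _).mpr hxm'⟩, ?_⟩
    rintro q ⟨hq, hxq⟩ _
    haveI := hq
    exact (hmaxP q ((Ideal.span_singleton_le_iff_mem _).mp hxq)).symm.le
  have hht : (maximalIdeal Y').height ≤ 1 :=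
    Ideal.height_le_one_of_isPrincipal_of_mem_minimalPrimes _ _ hmin
  -- but `dim Y' = dim Y ≥ 2`
  have hdimY' : ringKrullDim Y' = ringKrullDim Y :=
    (Literature.RingTheory.KrullDimension.ringKrullDim_eq_of_isIntegral (R := Y) (S := Y') hinj).symm
  have h2 : (2 : WithBot ℕ∞) ≤ ((maximalIdeal Y').height : WithBot ℕ∞) := by
    rw [IsLocalRing.maximalIdeal_height_eq_ringKrullDim, hdimY']; exact hdim
  have h2' : (2 : ℕ∞) ≤ (maximalIdeal Y').height := by
    have : ((2 : ℕ∞) : WithBot ℕ∞) ≤ ((maximalIdeal Y').height : WithBot ℕ∞) := by simpa using h2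
    exact WithBot.coe_le_coe.mp this
  have : (2 : ℕ∞) ≤ 1 := h2'.trans hht
  exact absurd this (by decide)

end IntegralNotQuadratic

end Summit.ResolutionOfSingularities.ResolutionOfSingularities.Theorems.SwitchingDichotomy

end
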